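import Literature.AnabelianGeometry.SemiGraphs.TemperedCurveBridge
import Literature.AnabelianGeometry.SemiGraphs.TemperedDecompositionCompact
import HarnessLib

/-!
# [SemiAnbd] Example 3.10 for a finite étale covering: the group-level datum of an OPEN subgroup
# `Π^tp_{X'} ⊆ Π^tp_X` with the same base field

Mochizuki, *Semi-graphs of anabelioids*, Publ. RIMS **42** (2006) [SemiAnbd], Example 3.10 pp. 43–45
("Let `K` be a finite extension of `ℚ_p` … `X^log_K` a smooth log curve over `K` … `π₁^temp(X^log_K)` is a
tempered topological group … fits into a natural exact sequence `1 → π₁^temp(X^log_K̄) → π₁^temp(X^log_K) → G_K → 1`";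
p. 45 "both `Δ` and `Π` are temp-slim") [cite: MochizukiSemiAnbd2006, Ex 3.10 pp.43-45].

abc-iut cell, layer L2 row W3-L2-01 «§5 GENUINE DATA» (seat abc-iut-L2-t4, gen 4); generic [SemiAnbd]
vocabulary needed to read [EtTh] §5 (p. 322, PDF p. 96: "the double underline case", base category
`D = B^temp(Π^tp_X̲̲)⁰`) over the §1 `ThetaSetting`: the curve `X̲̲ → X` is a connected finite étale covering
defined over the SAME field `K` ([EtTh] Def. 2.5 (i), Prop. 2.2 (iii) "`G_K ≅ Π_X̲̲/Δ_X̲̲`"), so its tempered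
fundamental group is the OPEN subgroup `Π^tp_X̲̲ ⊆ Π^tp_X`, and Example 3.10 applies to it verbatim.

* `TemperedArithmeticGroup.ofOpenSubgroup X U hU haug` — for abc-iut-L3-t2's group-level interface
  `X : TemperedArithmeticGroup K` ([SemiAnbd] Ex. 3.10) and an OPEN subgroup `U ⊆ Π` whose image under the
  augmentation is all of `G_K` (the covering is geometrically connected over `K`), the Example 3.10 datum
  OF THE COVERING: `Π := U`, `aug := aug|_U`; "tempered" by `IsTempered.subgroup_of_isClosed` (closed
  subgroups of tempered groups are tempered; open subgroups are closed), "temp-slim" because an open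
  subgroup of an open subgroup is open, Galois-countable as a subspace.  Every field is CONSTRUCTED /
  PROVED from `X`; no parameter, no named fact.
* `TemperedCurve.temperedArithmeticGroupOfOpenSubgroup X d U hU haug` — the same over abc-iut-L3's
  curve-level interface `X : TemperedCurve p` with its `GroupLevelData d` (`TemperedCurveBridge.lean`), for
  `U ⊆ Π^temp_{X_K}` open with `aug(U) = G_K`.
(abc-iut-L6-t7's `TemperedCurve.ofOpenSubgroup` (`TemperedCurveOfOpenSubgroup.lean`) is the CURVE-level
companion — cusps, decomposition groups, profinite completion — for finite-index `U` and a possibly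
smaller base field; the present file is the cusp-free GROUP-level datum every `BTemp`-consumer needs.)

HONEST FRAMING: [SemiAnbd] is refereed, pre-IUT mathematics; nothing here asserts that such data exist
for an actual curve; nothing bears on [IUTchIII] Cor. 3.12.
-/

noncomputable section

namespace Literature.AnabelianGeometry.SemiGraphs

open Literature.AlgebraicGeometry.Frobenioids (IsSlimGroup)
open _root_.Topology

universe u v

/-! ### Two classical lemmas on temp-slimness -/

section Slim

/-- **Open subgroups of slim groups are slim**: an open subgroup of an open subgroup `H` is open in
`G`, so its centraliser in `G`, a fortiori in `H`, is trivial ([SemiAnbd] Ex. 3.10 p. 45 "temp-slim";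
[FrdI] §0 p. 13).  (Import-light private copy of `IsSlimGroup.subgroup_of_isOpen` of
`AbsoluteAnabelian/AbsTopIChainsRemark422.lean`, to keep this [SemiAnbd] file below layer L4.)
[cite: MochizukiSemiAnbd2006, Ex 3.10 p.45] -/
private theorem isSlimGroup_subgroup_of_isOpen_aux {G : Type u} [Group G] [TopologicalSpace G] [ContinuousMul G]
    (hG : IsSlimGroup G) (H : Subgroup G) (hH : IsOpen (H : Set G)) : IsSlimGroup H := by
  refine ⟨fun U hU => ?_⟩
  have hUo : IsOpen ((U.map H.subtype : Subgroup G) : Set G) := by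
    have : ((U.map H.subtype : Subgroup G) : Set G) = Subtype.val '' (U : Set H) := by
      ext x; simp
    rw [this]
    exact hH.isOpenMap_subtype_val _ hU
  have hc := hG.centralizer_eq_bot _ hUo
  refine (Subgroup.eq_bot_iff_forall _).mpr fun c hc' => ?_
  have hcG : (c : G) ∈ Subgroup.centralizer ((U.map H.subtype : Subgroup G) : Set G) := by
    rw [Subgroup.mem_centralizer_iff]
    rintro _ ⟨u, hu, rfl⟩
    exact congrArg Subtype.val (Subgroup.mem_centralizer_iff.mp hc' u hu)
  rw [hc] at hcG
  exact Subtype.ext (Subgroup.mem_bot.mp hcG)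

/-- **Slimness is invariant under isomorphisms of topological groups** ([FrdI] §0 p. 13; private copy of
the transport lemma of `SemiGraphs/OncePuncturedTemperedGroupPadicWitness.lean`). [cite: MochizukiFrdI2008, §0 p.13] -/
private theorem isSlimGroup_of_continuousMulEquiv_aux {A : Type u} {B : Type v} [Group A] [TopologicalSpace A]
    [Group B] [TopologicalSpace B] (e : A ≃ₜ* B) (hA : IsSlimGroup A) : IsSlimGroup B := by
  refine ⟨fun U hU => ?_⟩
  have hU' : IsOpen ((U.comap e.toMulEquiv.toMonoidHom : Subgroup A) : Set A) := hU.preimage e.continuous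
  have h := hA.centralizer_eq_bot _ hU'
  refine (Subgroup.eq_bot_iff_forall _).mpr fun c hc => ?_
  have hc' : e.symm c ∈ Subgroup.centralizer ((U.comap e.toMulEquiv.toMonoidHom : Subgroup A) : Set A) := by
    rw [Subgroup.mem_centralizer_iff]
    intro x hx
    have hx' : e x ∈ U := hx
    have := Subgroup.mem_centralizer_iff.mp hc (e x) hx'
    apply e.injective
    simpa [map_mul] using this
  rw [h] at hc'
  have : e.symm c = 1 := Subgroup.mem_bot.mp hc'
  simpa using congrArg e this

end Slim

/-! ### Example 3.10 for an open subgroup with full Galois image -/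

namespace TemperedArithmeticGroup

variable {K : Type u} [Field K] (X : TemperedArithmeticGroup K) (U : Subgroup X.Pi)

/-- The augmentation of the covering: `aug|_U : U → G_K` ([SemiAnbd] Ex. 3.10 p. 43, applied to the
covering classified by `U`). [cite: MochizukiSemiAnbd2006, Ex 3.10 p.43] -/
def augOfSubgroup : U →ₜ* Field.absoluteGaloisGroup K :=
  X.aug.comp (ContinuousMonoidHom.mk U.subtype continuous_subtype_val)

/-- Values of `augOfSubgroup`. [cite: MochizukiSemiAnbd2006, Ex 3.10 p.43] -/
@[simp] theorem augOfSubgroup_apply (g : U) : X.augOfSubgroup U g = X.aug g := rfl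

/-- The kernel of `aug|_U` is `Δ ∩ U` read in `U`. [cite: MochizukiSemiAnbd2006, Ex 3.10 p.43] -/
theorem mem_ker_augOfSubgroup_iff (g : U) :
    g ∈ (X.augOfSubgroup U).toMonoidHom.ker ↔ (g : X.Pi) ∈ X.delta := Iff.rfl

/-- The kernel of `aug|_U` is closed in `U` (it is `U ∩ Δ`, and `Δ = aug⁻¹(1)` is closed: the Krull
topology on `G_K` is Hausdorff). [cite: MochizukiSemiAnbd2006, Ex 3.10 p.43] -/
theorem isClosed_ker_augOfSubgroup : IsClosed (((X.augOfSubgroup U).toMonoidHom.ker : Subgroup U) : Set U) := by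
  haveI : T2Space (Field.absoluteGaloisGroup K) := krullTopology_t2
  rw [MonoidHom.coe_ker]
  exact isClosed_singleton.preimage (X.augOfSubgroup U).continuous

/-- `Δ ∩ U` read in `Δ` and read in `U`: the same topological group (bookkeeping isomorphism used to
transport temp-slimness of `Δ`). [cite: MochizukiSemiAnbd2006, Ex 3.10 p.43] -/
def deltaInfEquivKer : U.subgroupOf X.delta ≃ₜ* (X.augOfSubgroup U).toMonoidHom.ker where
  toFun g := ⟨⟨(g : X.delta), g.2⟩, (g : X.delta).2⟩
  invFun g := ⟨⟨(g : U), g.2⟩, (g : U).2⟩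
  left_inv _ := rfl
  right_inv _ := rfl
  map_mul' _ _ := rfl
  continuous_toFun := by fun_prop
  continuous_invFun := by fun_prop

variable (hU : IsOpen (U : Set X.Pi)) (haug : U.map X.aug.toMonoidHom = ⊤)

include haug in
/-- `aug|_U` is surjective when `aug(U) = G_K` (the covering is geometrically connected over `K`).
[cite: MochizukiSemiAnbd2006, Ex 3.10 p.43] -/
theorem augOfSubgroup_surjective : Function.Surjective (X.augOfSubgroup U) := by
  intro γ
  have hγ : γ ∈ U.map X.aug.toMonoidHom := by rw [haug]; trivial
  obtain ⟨g, hg, rfl⟩ := hγ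
  exact ⟨⟨g, hg⟩, rfl⟩

/-- **[SemiAnbd] Example 3.10 for the finite étale covering classified by an open subgroup `U ⊆ Π` with
`aug(U) = G_K`**: the group-level datum with `Π := U`, `aug := aug|_U` — tempered (closed subgroup of a
tempered group), `Δ_U = Δ ∩ U` tempered, both temp-slim (open subgroups of temp-slim groups),
Galois-countable.  Constructed, nothing assumed. [cite: MochizukiSemiAnbd2006, Ex 3.10 pp.43-45] -/
def ofOpenSubgroup : TemperedArithmeticGroup K where
  Pi := U
  isTempered := X.isTempered.subgroup_of_isClosed U (U.isClosed_of_isOpen hU)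
  aug := X.augOfSubgroup U
  aug_surjective := X.augOfSubgroup_surjective U haug
  isTempered_ker :=
    (X.isTempered.subgroup_of_isClosed U (U.isClosed_of_isOpen hU)).subgroup_of_isClosed _
      (X.isClosed_ker_augOfSubgroup U)
  isSlimGroup := isSlimGroup_subgroup_of_isOpen_aux X.isSlimGroup U hU
  isSlimGroup_ker :=
    isSlimGroup_of_continuousMulEquiv_aux (X.deltaInfEquivKer U)
      (isSlimGroup_subgroup_of_isOpen_aux X.isSlimGroup_ker (U.subgroupOf X.delta)
        (hU.preimage continuous_subtype_val))
  secondCountableTopology := by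
    haveI := X.secondCountableTopology
    exact TopologicalSpace.Subtype.secondCountableTopology (U : Set X.Pi)

/-- The group of the covering datum is `U` (definitionally). [cite: MochizukiSemiAnbd2006, Ex 3.10 p.43] -/
@[simp] theorem ofOpenSubgroup_Pi : (X.ofOpenSubgroup U hU haug).Pi = U := rfl

/-- Its augmentation is `aug|_U` (definitionally). [cite: MochizukiSemiAnbd2006, Ex 3.10 p.43] -/
@[simp] theorem ofOpenSubgroup_aug_apply (g : U) : (X.ofOpenSubgroup U hU haug).aug g = X.aug g := rfl

/-- `Δ` of the covering datum is `Δ ∩ U` read in `U`. [cite: MochizukiSemiAnbd2006, Ex 3.10 p.43] -/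
theorem mem_ofOpenSubgroup_delta_iff (g : U) : g ∈ (X.ofOpenSubgroup U hU haug).delta ↔ (g : X.Pi) ∈ X.delta :=
  Iff.rfl

end TemperedArithmeticGroup

/-! ### The same over the curve-level interface `TemperedCurve p` -/

namespace TemperedCurve

variable {p : ℕ} [Fact p.Prime] (X : TemperedCurve p) (d : X.GroupLevelData) (U : Subgroup X.PiTemp)
  (hU : IsOpen (U : Set X.PiTemp)) (haug : U.map X.aug.toMonoidHom = X.GK)

include haug in
/-- `aug(U) = G_K ≤ G_{ℚ_p}` read through the identification `ι : G_K ≃ Gal(K̄/K)` of the bridge: the image of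
`U` under `augK ι` is everything. [cite: MochizukiSemiAnbd2006, §6 p.69] -/
theorem map_augK_eq_top_of_map_aug_eq (ι : X.GK ≃ₜ* Field.absoluteGaloisGroup X.K) :
    U.map (X.augK ι).toMonoidHom = ⊤ := by
  rw [eq_top_iff]
  rintro γ -
  have hγ : ((ι.symm γ : X.GK) : GQp p) ∈ U.map X.aug.toMonoidHom := by rw [haug]; exact (ι.symm γ).2
  obtain ⟨g, hg, hgγ⟩ := hγ
  refine ⟨g, hg, ?_⟩
  have h1 : X.augGK g = ι.symm γ := Subtype.ext (by simpa using hgγ)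
  change ι (X.augGK g) = γ
  rw [h1, ι.apply_symm_apply]

/-- **Example 3.10 for the covering `X_U → X_K` classified by an open `U ⊆ Π^temp_{X_K}` with `aug(U) = G_K`**,
over the curve-level interface and its `GroupLevelData`: `TemperedArithmeticGroup.ofOpenSubgroup` of the bridge
datum `X.toTemperedArithmeticGroup d`. [cite: MochizukiSemiAnbd2006, Ex 3.10 pp.43-45] -/
def temperedArithmeticGroupOfOpenSubgroup : TemperedArithmeticGroup X.K :=
  (X.toTemperedArithmeticGroup d).ofOpenSubgroup U hU (X.map_augK_eq_top_of_map_aug_eq U haug d.galEquiv)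

/-- Its group is `U` (definitionally). [cite: MochizukiSemiAnbd2006, Ex 3.10 p.43] -/
@[simp] theorem temperedArithmeticGroupOfOpenSubgroup_Pi :
    (X.temperedArithmeticGroupOfOpenSubgroup d U hU haug).Pi = U := rfl

/-- Its augmentation is `augK ι|_U` (definitionally). [cite: MochizukiSemiAnbd2006, Ex 3.10 p.43] -/
@[simp] theorem temperedArithmeticGroupOfOpenSubgroup_aug_apply (g : U) :
    (X.temperedArithmeticGroupOfOpenSubgroup d U hU haug).aug g = X.augK d.galEquiv g := rfl

/-- `Δ` of the covering datum is `Δ^temp_X ∩ U`: `g ∈ Δ_U ↔ g ∈ Δ^temp_X = Ker(aug)`.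
[cite: MochizukiSemiAnbd2006, Ex 3.10 p.43] -/
theorem mem_temperedArithmeticGroupOfOpenSubgroup_delta_iff (g : U) :
    g ∈ (X.temperedArithmeticGroupOfOpenSubgroup d U hU haug).delta ↔ (g : X.PiTemp) ∈ X.DeltaTemp :=
  (TemperedArithmeticGroup.mem_ofOpenSubgroup_delta_iff (X.toTemperedArithmeticGroup d) U hU
    (X.map_augK_eq_top_of_map_aug_eq U haug d.galEquiv) g).trans (by rw [toTemperedArithmeticGroup_delta]; exact Iff.rfl)

end TemperedCurve

end Literature.AnabelianGeometry.SemiGraphs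

end
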